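import Literature.Probability.Percolation.ProdBernoulliRusso
import Literature.Probability.Percolation.ClusterBoundary
import HarnessLib

/-!
# Sharpness for long-range percolation, II: the mean-field differential inequality in finite volume

Topic `Literature/Probability/Percolation`. Second part of the Duminil-Copin–Tassion (CMP 343
(2016), §1) proof of sharpness for long-range percolation with a kernel `J` on `ℤ^d`
(`kernelPercolation J β`), needed by Hutchcroft 2022 (Prop. 2.4 / 2.7): **Lemma 1.4**, the
differential inequality "`d/dβ ℙ[0 ↔ Λ^c] ≥ (1/β) inf_{S ⊆ Λ, 0 ∈ S} φ_β(S) (1 - ℙ[0 ↔ Λ^c])`".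
Following DCT's Remark 1.1 ("Russo's formula is possibly used in infinite volume, since the model
can be infinite-range. There is no difficulty resolving this technical issue … by finite volume
approximation"), we work with the exit event truncated to a finite set `T ⊇ B` of possible exit
endpoints, which is an increasing event determined by finitely many edges of the ORIGINAL model, so
that Russo's formula (`hasDerivAt_kernelPercolation_real`, `ProdBernoulliRusso.lean`) applies
verbatim; the limit `T ↑ ℤ^d` is taken in the sequel file.

* `internalEdges B`, `exitEdges B T`, `IntConn B ω z x` (connection inside `B`),
  `ExitVia B T z ω` (`z ↔ out`: `z` is joined inside `B` to a vertex of `B` with an open edge into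
  `T \ B`), `notExitSet B T ω` (DCT's random set `𝒮 = {z ∈ B : z ↮ out}`), `kernelPsiIn J β S T`
  (`ψ^T_β(S) = Σ_{x ∈ S} Σ_{y ∈ T \ S} J_{xy} ℙ_β(0 ↔ x in S)`, the `J`-form of `φ_β(S)/β`:
  `1 - e^{-βJ} ≤ βJ`);
* finite dependence: `{z ↔ out}` is determined by `internalEdges B ∪ exitEdges B T`, `{0 ↔ x in S}`
  by `internalEdges S`, and **`{𝒮 = S}` by the edges not inside `S`**
  (`determinedBy_notExitSet_eq`, the last-exit argument), whence independence of `{𝒮 = S}` and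
  `{0 ↔ x in S}`;
* **pivotality** (`isPivotal_exitVia_of_notExitSet_eq`): on `{𝒮 = S}`, `0 ↔ x in S`, `y ∈ T \ S`,
  the (closed) edge `{x, y}` is pivotal for `{0 ↔ out}`;
* `intConn_iff_mem_openConnIn` — `IntConn S ω 0 x ↔ ω ∈ {0 ↔ x in S}` (`openConnIn`);
* **`hasDerivAt_real_exitVia_ge`** — DCT16 Lemma 1.4 in finite volume: for `β > 0`, `0 ∈ B`,
  `d/dβ ℙ_β(0 ↔ out) ≥ (min_{S ⊆ B, 0 ∈ S} ψ^T_β(S)) (1 - ℙ_β(0 ↔ out))`, the derivative being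
  Russo's `Σ_e J_e e^{-βJ_e} ℙ_β(e pivotal)`; proof as printed: `e^{-βJ_e} ℙ(e piv) =
  ℙ(e piv, e closed) ≥ ℙ(e piv, 0 ↮ out) ≥ Σ_{S ∋ 0} ℙ(e piv, 𝒮 = S)`, restrict to boundary
  edges, pivotality, independence, `Σ_{S ∋ 0} ℙ(𝒮 = S) = 1 - ℙ(0 ↔ out)`.

## References

* [DuminilCopinTassionCMP2016] H. Duminil-Copin, V. Tassion, Comm. Math. Phys. 343 (2016)
  725–745, arXiv:1502.03050: Lemma 1.4 and its proof, Remark 1.1.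
* [Hutchcroft2022] T. Hutchcroft, J. Math. Phys. 63 (2022), arXiv:2202.07634, Prop. 2.4 / 2.7.
-/

noncomputable section

namespace Literature.Probability.Percolation

open MeasureTheory Finset Literature.Probability.LatticeModels

variable {V : Type*} [DecidableEq V]

/-! ### Internal edges, exit edges, and the truncated exit event -/

/-- The internal edges of the finite vertex set `B`: unordered pairs of distinct vertices of `B`.
[folklore] -/
def internalEdges (B : Finset V) : Finset (Sym2 V) := B.sym2.filter fun e => ¬e.IsDiag

/-- The exit edges from `B` into the finite set `T`: pairs `{x, y}` with `x ∈ B`, `y ∈ T \ B`.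
(Truncation to `T` of Duminil-Copin–Tassion's "external boundary" edges of `B`, cf. their
Remark 1.1 on finite-volume approximation.) [cite: DuminilCopinTassionCMP2016, Remark 1.1] -/
def exitEdges (B T : Finset V) : Finset (Sym2 V) :=
  (B ×ˢ (T \ B)).image fun p => s(p.1, p.2)

/-- Membership in `internalEdges`. [folklore] -/
@[simp] theorem mk_mem_internalEdges {B : Finset V} {x y : V} :
    s(x, y) ∈ internalEdges B ↔ x ∈ B ∧ y ∈ B ∧ x ≠ y := by
  simp [internalEdges, and_assoc]

/-- Membership in `exitEdges`. [folklore] -/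
theorem mk_mem_exitEdges {B T : Finset V} {x y : V} (hx : x ∈ B) :
    s(x, y) ∈ exitEdges B T ↔ y ∈ T ∧ y ∉ B := by
  simp only [exitEdges, Finset.mem_image, Finset.mem_product, Finset.mem_sdiff, Prod.exists]
  constructor
  · rintro ⟨a, b, ⟨ha, hbT, hbB⟩, hab⟩
    rcases Sym2.eq_iff.1 hab with ⟨rfl, rfl⟩ | ⟨rfl, rfl⟩
    · exact ⟨hbT, hbB⟩
    · exact absurd hx hbB
  · rintro ⟨hyT, hyB⟩
    exact ⟨x, y, ⟨hx, hyT, hyB⟩, rfl⟩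

/-- An exit edge has an endpoint in `B` and one in `T \ B`. [folklore] -/
theorem exists_of_mem_exitEdges {B T : Finset V} {e : Sym2 V} (he : e ∈ exitEdges B T) :
    ∃ x y, e = s(x, y) ∧ x ∈ B ∧ y ∈ T ∧ y ∉ B := by
  simp only [exitEdges, Finset.mem_image, Finset.mem_product, Finset.mem_sdiff, Prod.exists] at he
  obtain ⟨a, b, ⟨ha, hbT, hbB⟩, rfl⟩ := he
  exact ⟨a, b, rfl, ha, hbT, hbB⟩

/-- Internal and exit edges are disjoint. [folklore] -/
theorem disjoint_internalEdges_exitEdges (B T : Finset V) :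
    Disjoint (internalEdges B) (exitEdges B T) := by
  rw [Finset.disjoint_left]
  intro e he he'
  obtain ⟨x, y, rfl, hx, -, hyB⟩ := exists_of_mem_exitEdges he'
  exact hyB (mk_mem_internalEdges.1 he).2.1

/-- **Internal connection** inside `B`: an open path all of whose edges are internal edges of `B`
(equivalently, all of whose vertices lie in `B`), i.e. reachability in the open graph of
`ω ∩ internalEdges B`. [cite: DuminilCopinTassionCMP2016, §1.1 ("connected in S")] -/
def IntConn (B : Finset V) (ω : BondConfig V) (z x : V) : Prop :=
  (openGraph (ω ∩ ↑(internalEdges B))).Reachable z x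

/-- **The truncated exit event** `{z ↔ out}`: `z` is joined inside `B` to a vertex of `B` carrying
an open exit edge into `T \ B` (Duminil-Copin–Tassion's `{z ↔ Λ^c}` with the infinite-range
exit edges truncated to the finite set `T`, Remark 1.1).
[cite: DuminilCopinTassionCMP2016, Lemma 1.4 and Remark 1.1] -/
def ExitVia (B T : Finset V) (z : V) (ω : BondConfig V) : Prop :=
  ∃ x, x ∈ B ∧ IntConn B ω z x ∧ ∃ y, y ∈ T ∧ y ∉ B ∧ s(x, y) ∈ ω

/-- The random set `𝒮 = {z ∈ B : z ↮ out}` of Duminil-Copin–Tassion ("`𝒮 := {x ∈ Λ such that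
x ↮ Λ^c}`"), for the truncated exit event. [cite: DuminilCopinTassionCMP2016, proof of Lemma 1.4] -/
def notExitSet (B T : Finset V) (ω : BondConfig V) : Finset V :=
  @Finset.filter _ (fun z => ¬ExitVia B T z ω) (Classical.decPred _) B

/-! ### Elementary properties -/

/-- Adjacency in the internal open graph. [folklore] -/
theorem intGraph_adj {B : Finset V} {ω : BondConfig V} {a b : V} :
    (openGraph (ω ∩ ↑(internalEdges B))).Adj a b ↔ s(a, b) ∈ ω ∧ a ∈ B ∧ b ∈ B ∧ a ≠ b := by
  rw [openGraph_adj, Set.mem_inter_iff, Finset.mem_coe, mk_mem_internalEdges]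
  tauto

/-- Internal connection is reflexive. [folklore] -/
theorem IntConn.refl (B : Finset V) (ω : BondConfig V) (z : V) : IntConn B ω z z :=
  SimpleGraph.Reachable.refl z

/-- Internal connection is symmetric. [folklore] -/
theorem IntConn.symm {B : Finset V} {ω : BondConfig V} {z x : V} (h : IntConn B ω z x) :
    IntConn B ω x z := SimpleGraph.Reachable.symm h

/-- Internal connection is transitive. [folklore] -/
theorem IntConn.trans {B : Finset V} {ω : BondConfig V} {z x w : V} (h : IntConn B ω z x)
    (h' : IntConn B ω x w) : IntConn B ω z w := SimpleGraph.Reachable.trans h h'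

/-- Internal connection is monotone in the configuration. [folklore] -/
theorem IntConn.mono {B : Finset V} {ω ω' : BondConfig V} (hle : ω ⊆ ω') {z x : V}
    (h : IntConn B ω z x) : IntConn B ω' z x :=
  SimpleGraph.Reachable.mono (openGraph_mono (Set.inter_subset_inter_left _ hle)) h

/-- An internally connected vertex other than the start lies in `B`. [folklore] -/
theorem IntConn.mem_of_ne {B : Finset V} {ω : BondConfig V} {z x : V} (h : IntConn B ω z x)
    (hzx : z ≠ x) : x ∈ B := by
  obtain ⟨w⟩ := h
  induction w with
  | nil => exact absurd rfl hzx
  | @cons a b c hadj w ih =>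
    by_cases hbc : b = c
    · subst hbc; exact (intGraph_adj.1 hadj).2.2.1
    · exact ih hbc

/-- One open internal step extends an internal connection. [folklore] -/
theorem IntConn.tail {B : Finset V} {ω : BondConfig V} {z x y : V} (h : IntConn B ω z x)
    (hxy : s(x, y) ∈ ω) (hx : x ∈ B) (hy : y ∈ B) (hne : x ≠ y) : IntConn B ω z y :=
  h.trans (SimpleGraph.Adj.reachable (intGraph_adj.2 ⟨hxy, hx, hy, hne⟩))

/-- The exit event is increasing. [folklore] -/
theorem ExitVia.mono {B T : Finset V} {z : V} {ω ω' : BondConfig V} (hle : ω ⊆ ω')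
    (h : ExitVia B T z ω) : ExitVia B T z ω' := by
  obtain ⟨x, hxB, hzx, y, hyT, hyB, hxy⟩ := h
  exact ⟨x, hxB, hzx.mono hle, y, hyT, hyB, hle hxy⟩

/-- `{z ↔ out}` is an increasing event. [folklore] -/
theorem isUpperSet_exitVia (B T : Finset V) (z : V) : IsUpperSet {ω : BondConfig V | ExitVia B T z ω} :=
  fun _ _ hle h => ExitVia.mono hle h

/-- Internally connected vertices exit together. [folklore] -/
theorem ExitVia.of_intConn {B T : Finset V} {z x : V} {ω : BondConfig V} (h : IntConn B ω z x)
    (hx : ExitVia B T x ω) : ExitVia B T z ω := by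
  obtain ⟨x', hx'B, hxx', y, hyT, hyB, hx'y⟩ := hx
  exact ⟨x', hx'B, h.trans hxx', y, hyT, hyB, hx'y⟩

/-- Membership in `𝒮`. [folklore] -/
theorem mem_notExitSet {B T : Finset V} {ω : BondConfig V} {z : V} :
    z ∈ notExitSet B T ω ↔ z ∈ B ∧ ¬ExitVia B T z ω := by
  unfold notExitSet
  rw [@Finset.mem_filter]

/-- `𝒮 ⊆ B`. [folklore] -/
theorem notExitSet_subset (B T : Finset V) (ω : BondConfig V) : notExitSet B T ω ⊆ B :=
  fun _ hz => (mem_notExitSet.1 hz).1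

/-! ### Finite dependence -/

/-- Internal connection only depends on the internal edges. [folklore] -/
theorem intConn_inter_iff {B : Finset V} {ω : BondConfig V} {F : Set (Sym2 V)}
    (hF : ↑(internalEdges B) ⊆ F) {z x : V} : IntConn B (ω ∩ F) z x ↔ IntConn B ω z x := by
  unfold IntConn
  rw [Set.inter_assoc, Set.inter_eq_self_of_subset_right hF]

/-- `{z ↔ out}` is determined by the internal and exit edges. [folklore] -/
theorem determinedBy_exitVia (B T : Finset V) (z : V) :
    DeterminedBy {ω : BondConfig V | ExitVia B T z ω} (↑(internalEdges B ∪ exitEdges B T)) := by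
  rw [determinedBy_iff]
  suffices key : ∀ ω ω' : BondConfig V,
      ω ∩ ↑(internalEdges B ∪ exitEdges B T) = ω' ∩ ↑(internalEdges B ∪ exitEdges B T) →
      ExitVia B T z ω → ExitVia B T z ω' from
    fun ω ω' h => ⟨key ω ω' h, key ω' ω h.symm⟩
  intro ω ω' h ⟨x, hxB, hzx, y, hyT, hyB, hxy⟩
  have hsub : (↑(internalEdges B) : Set (Sym2 V)) ⊆ ↑(internalEdges B ∪ exitEdges B T) := by
    rw [Finset.coe_union]; exact Set.subset_union_left
  have hzx' : IntConn B ω' z x := by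
    rw [← intConn_inter_iff hsub] at hzx ⊢
    rwa [← h]
  have he : s(x, y) ∈ internalEdges B ∪ exitEdges B T :=
    Finset.mem_union_right _ ((mk_mem_exitEdges hxB).2 ⟨hyT, hyB⟩)
  have : s(x, y) ∈ ω' ∩ ↑(internalEdges B ∪ exitEdges B T) := by
    rw [← h]; exact ⟨hxy, he⟩
  exact ⟨x, hxB, hzx', y, hyT, hyB, this.1⟩

omit [DecidableEq V] in
/-- First-exit decomposition of a walk (private copy of the lemma of `LongRangeSimonLieb.lean`).
[folklore] -/
private theorem walk_exit_decomposition {G : SimpleGraph V} (S : Set V) :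
    ∀ {a b : V} (p : G.Walk a b), a ∈ S → b ∉ S →
      ∃ (y w : V) (p₁ : G.Walk a y) (p₂ : G.Walk w b), G.Adj y w ∧
        (∀ v ∈ p₁.support, v ∈ S) ∧ w ∉ S ∧ p.edges = p₁.edges ++ s(y, w) :: p₂.edges
  | _, _, SimpleGraph.Walk.nil, ha, hb => absurd ha hb
  | a, b, SimpleGraph.Walk.cons (v := a') hadj p, ha, hb => by
    by_cases ha' : a' ∈ S
    · obtain ⟨y, w, p₁, p₂, hyw, hS, hw, hedges⟩ := walk_exit_decomposition S p ha' hb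
      refine ⟨y, w, SimpleGraph.Walk.cons hadj p₁, p₂, hyw, ?_, hw, ?_⟩
      · intro v hv
        rw [SimpleGraph.Walk.support_cons, List.mem_cons] at hv
        rcases hv with rfl | hv
        · exact ha
        · exact hS v hv
      · rw [SimpleGraph.Walk.edges_cons, SimpleGraph.Walk.edges_cons, hedges]; rfl
    · exact ⟨a, a', SimpleGraph.Walk.nil, p, hadj, by simpa using ha, ha', by simp⟩

/-- A walk of the internal open graph of `ω` all of whose edges lie in `ω'` is a walk of the
internal open graph of `ω'`. [folklore] -/
theorem intConn_of_walk {B : Finset V} {ω ω' : BondConfig V} {z x : V}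
    (w : (openGraph (ω ∩ ↑(internalEdges B))).Walk z x) (hw : ∀ e ∈ w.edges, e ∈ ω') :
    IntConn B ω' z x := by
  refine ⟨w.transfer (openGraph (ω' ∩ ↑(internalEdges B))) fun e he => ?_⟩
  have heω := w.edges_subset_edgeSet he
  induction e using Sym2.ind with
  | h a b =>
    rw [SimpleGraph.mem_edgeSet] at heω ⊢
    rw [intGraph_adj] at heω ⊢
    exact ⟨hw _ he, heω.2⟩

/-- **`{𝒮 = S}` is determined by the edges not inside `S`** (Duminil-Copin–Tassion's observation
that `{𝒮 = S}` is measurable with respect to the edges with an endpoint outside `S`, proof of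
Lemma 1.4: last exit from `S` of an exit path). [cite: DuminilCopinTassionCMP2016, proof of Lemma 1.4] -/
theorem determinedBy_notExitSet_eq (B T S : Finset V) :
    DeterminedBy {ω : BondConfig V | notExitSet B T ω = S}
      (↑((internalEdges B \ internalEdges S) ∪ exitEdges B T)) := by
  classical
  set F : Finset (Sym2 V) := (internalEdges B \ internalEdges S) ∪ exitEdges B T with hF
  rw [determinedBy_iff]
  suffices key : ∀ ω ω' : BondConfig V, ω ∩ ↑F = ω' ∩ ↑F →
      notExitSet B T ω = S → notExitSet B T ω' = S from
    fun ω ω' h => ⟨key ω ω' h, key ω' ω h.symm⟩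
  intro ω ω' h hS
  -- transfer of `F`-edges between the two configurations
  have hmemF : ∀ e ∈ F, (e ∈ ω ↔ e ∈ ω') := by
    intro e he
    have := Set.ext_iff.1 h e
    simp only [Set.mem_inter_iff, Finset.mem_coe, he, and_true] at this
    exact this
  have hSB : S ⊆ B := hS ▸ notExitSet_subset B T ω
  -- an internal edge with an endpoint outside `S` lies in `F`
  have hedgeF : ∀ a b : V, s(a, b) ∈ internalEdges B → (a ∉ S ∨ b ∉ S) → s(a, b) ∈ F := by
    intro a b hab hout
    refine Finset.mem_union_left _ (Finset.mem_sdiff.2 ⟨hab, fun h' => ?_⟩)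
    have := mk_mem_internalEdges.1 h'
    rcases hout with h | h
    · exact h this.1
    · exact h this.2.1
  -- (a) vertices of `B \\ S` exit in `ω'`
  have hexit : ∀ z ∈ B, z ∉ S → ExitVia B T z ω' := by
    intro z hzB hzS
    have hz : ExitVia B T z ω := by
      by_contra hcon
      exact hzS (hS ▸ mem_notExitSet.2 ⟨hzB, hcon⟩)
    obtain ⟨x, hxB, hzx, y, hyT, hyB, hxy⟩ := hz
    obtain ⟨w⟩ := hzx
    -- every vertex on the internal path exits in `ω`, hence lies outside `S`
    have hsupp : ∀ v ∈ w.support, v ∉ S := by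
      intro v hv hvS
      have hvx : IntConn B ω v x := (w.takeUntil v hv).reachable.symm.trans w.reachable
        |> fun h => by exact h
      have : ExitVia B T v ω := ⟨x, hxB, hvx, y, hyT, hyB, hxy⟩
      have hvS' : v ∈ notExitSet B T ω := hS ▸ hvS
      exact (mem_notExitSet.1 hvS').2 this
    have hw : ∀ e ∈ w.edges, e ∈ ω' := by
      intro e he
      have heE := w.edges_subset_edgeSet he
      induction e using Sym2.ind with
      | h a b =>
        rw [SimpleGraph.mem_edgeSet, intGraph_adj] at heE
        have haS : a ∉ S := hsupp a (w.fst_mem_support_of_mem_edges he)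
        exact (hmemF _ (hedgeF a b (mk_mem_internalEdges.2 ⟨heE.2.1, heE.2.2.1, heE.2.2.2⟩)
          (Or.inl haS))).1 heE.1
    have hxy' : s(x, y) ∈ ω' :=
      (hmemF _ (Finset.mem_union_right _ ((mk_mem_exitEdges hxB).2 ⟨hyT, hyB⟩))).1 hxy
    exact ⟨x, hxB, intConn_of_walk w hw, y, hyT, hyB, hxy'⟩
  -- (b) vertices of `S` do not exit in `ω'`
  have hnoexit : ∀ z ∈ S, ¬ExitVia B T z ω' := by
    intro z hzS ⟨x, hxB, hzx', y, hyT, hyB, hxy'⟩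
    have hxy : s(x, y) ∈ ω :=
      (hmemF _ (Finset.mem_union_right _ ((mk_mem_exitEdges hxB).2 ⟨hyT, hyB⟩))).2 hxy'
    -- some vertex of `S` exits in `ω`: contradiction with `𝒮(ω) = S`
    suffices hv : ∃ v ∈ S, ExitVia B T v ω by
      obtain ⟨v, hvS, hv⟩ := hv
      exact (mem_notExitSet.1 (hS ▸ hvS : v ∈ notExitSet B T ω)).2 hv
    by_cases hxS : x ∈ S
    · exact ⟨x, hxS, x, hxB, IntConn.refl B ω x, y, hyT, hyB, hxy⟩
    · obtain ⟨w'⟩ := hzx'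
      -- last visit to `S`: first exit from `Sᶜ` of the reversed walk
      obtain ⟨u, v, r₁, r₂, huv, hr₁, hvS, -⟩ :=
        walk_exit_decomposition ((↑S : Set V)ᶜ) w'.reverse (by simpa using hxS) (by simpa using hzS)
      simp only [Set.mem_compl_iff, Finset.mem_coe, not_not] at hvS hr₁
      refine ⟨v, hvS, x, hxB, ?_, y, hyT, hyB, hxy⟩
      -- `v ↔ x` internally in `ω`: the edge `{v,u}` and the reversed `r₁`, all outside `S`
      have huv' := huv
      rw [intGraph_adj] at huv'
      have hvu : IntConn B ω v u := by
        refine SimpleGraph.Adj.reachable (intGraph_adj.2 ⟨?_, huv'.2.2.1, huv'.2.1, huv'.2.2.2.symm⟩)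
        rw [Sym2.eq_swap]
        exact (hmemF _ (hedgeF u v (mk_mem_internalEdges.2 ⟨huv'.2.1, huv'.2.2.1, huv'.2.2.2⟩)
          (Or.inl (hr₁ u r₁.end_mem_support)))).2 huv'.1
      have hux : IntConn B ω u x := by
        refine intConn_of_walk r₁.reverse fun e he => ?_
        rw [SimpleGraph.Walk.edges_reverse, List.mem_reverse] at he
        have heE := r₁.edges_subset_edgeSet he
        induction e using Sym2.ind with
        | h a b =>
          rw [SimpleGraph.mem_edgeSet, intGraph_adj] at heE
          have haS : a ∉ S := hr₁ a (r₁.fst_mem_support_of_mem_edges he)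
          exact (hmemF _ (hedgeF a b (mk_mem_internalEdges.2 ⟨heE.2.1, heE.2.2.1, heE.2.2.2⟩)
            (Or.inl haS))).2 heE.1
      exact hvu.trans hux
  -- conclusion
  ext z
  rw [mem_notExitSet]
  constructor
  · rintro ⟨hzB, hz⟩
    by_contra hzS
    exact hz (hexit z hzB hzS)
  · intro hzS
    exact ⟨hSB hzS, hnoexit z hzS⟩

/-- **Internal connection inside `S` is determined by the internal edges of `S`.** [folklore] -/
theorem determinedBy_intConn (S : Finset V) (z x : V) :
    DeterminedBy {ω : BondConfig V | IntConn S ω z x} (↑(internalEdges S)) := by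
  rw [determinedBy_iff]
  intro ω ω' h
  simp only [Set.mem_setOf_eq, IntConn]
  rw [h]

/-- **Pivotality of the boundary edges of `𝒮`** (Duminil-Copin–Tassion, proof of Lemma 1.4: on
`{𝒮 = S}` with `0 ↔ x in S`, the closed edge `{x,y}`, `y ∉ S`, is pivotal for `{0 ↔ Λ^c}`): if
`𝒮(ω) = S ∋ o`, `x ∈ S` is joined to `o` inside `S` and `y ∈ T \ S`, then `{x, y}` is pivotal
for the exit event of `o`. [cite: DuminilCopinTassionCMP2016, proof of Lemma 1.4] -/
theorem isPivotal_exitVia_of_notExitSet_eq {B T S : Finset V} {ω : BondConfig V}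
    (hS : notExitSet B T ω = S) {o x y : V} (ho : o ∈ S) (hx : x ∈ S)
    (hox : IntConn S ω o x) (hyT : y ∈ T) (hyS : y ∉ S) :
    IsPivotal {ω : BondConfig V | ExitVia B T o ω} s(x, y) ω := by
  have hSB : S ⊆ B := hS ▸ notExitSet_subset B T ω
  have hxB : x ∈ B := hSB hx
  have hxy : x ≠ y := fun h => hyS (h ▸ hx)
  -- `o` does not exit in `ω`
  have ho' : ¬ExitVia B T o ω := (mem_notExitSet.1 (hS ▸ ho : o ∈ notExitSet B T ω)).2
  -- internal connection inside `S` gives internal connection inside `B`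
  have hoxB : IntConn B ω o x := by
    refine SimpleGraph.Reachable.mono (openGraph_mono (Set.inter_subset_inter_right _ ?_)) hox
    intro e he
    induction e using Sym2.ind with
    | h a b =>
      rw [Finset.mem_coe, mk_mem_internalEdges] at he ⊢
      exact ⟨hSB he.1, hSB he.2.1, he.2.2⟩
  unfold IsPivotal
  refine Or.inl ⟨?_, fun h => ho' (ExitVia.mono Set.sdiff_subset h)⟩
  -- opening `{x, y}` makes `o` exit
  change ExitVia B T o (insert s(x, y) ω)
  by_cases hyB : y ∈ B
  · -- `y ∈ B \ S` exits in `ω`; join `o ↔ x`, the edge `{x,y}`, and `y`'s exit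
    have hy : ExitVia B T y ω := by
      by_contra hcon
      exact hyS (hS ▸ mem_notExitSet.2 ⟨hyB, hcon⟩)
    obtain ⟨x', hx'B, hyx', y', hy'T, hy'B, hx'y'⟩ := hy
    refine ⟨x', hx'B, ?_, y', hy'T, hy'B, Set.mem_insert_of_mem _ hx'y'⟩
    have h1 : IntConn B (insert s(x, y) ω) o x := hoxB.mono (Set.subset_insert _ _)
    have h2 : IntConn B (insert s(x, y) ω) x y :=
      SimpleGraph.Adj.reachable (intGraph_adj.2 ⟨Set.mem_insert _ _, hxB, hyB, hxy⟩)
    exact (h1.trans h2).trans (hyx'.mono (Set.subset_insert _ _))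
  · exact ⟨x, hxB, hoxB.mono (Set.subset_insert _ _), y, hyT, hyB, Set.mem_insert _ _⟩

/-- A pivotal edge for an increasing event that fails is closed. [folklore] -/
theorem notMem_of_isPivotal_of_notMem {ι : Type*} {A : Set (Set ι)} (hA : IsUpperSet A) {e : ι}
    {ω : Set ι} (hpiv : IsPivotal A e ω) (hω : ω ∉ A) : e ∉ ω := by
  intro he
  unfold IsPivotal at hpiv
  rw [Set.insert_eq_of_mem he] at hpiv
  rcases hpiv with ⟨h, -⟩ | ⟨h, -⟩
  · exact hω h
  · exact hω (hA Set.sdiff_subset h)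

/-- **Internal connection inside `S` is connection in `S`**: for `o ∈ S`,
`IntConn S ω o x ↔ ω ∈ {o ↔ x in S}`. [folklore] -/
theorem intConn_iff_mem_openConnIn {S : Finset V} {o : V} (ho : o ∈ S) (ω : BondConfig V) (x : V) :
    IntConn S ω o x ↔ ω ∈ openConnIn (↑S : Set V) o x := by
  constructor
  · intro h
    refine DCT16.mem_openConnIn_of_pathIn ⟨Finset.mem_coe.2 ho, ?_⟩
    unfold IntConn at h
    rw [SimpleGraph.reachable_iff_reflTransGen] at h
    refine Relation.ReflTransGen.mono (p := fun a b => (openGraph ω).Adj a b ∧ b ∈ (↑S : Set V))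
      (fun a b hab => ?_) _ _ h
    rw [intGraph_adj] at hab
    exact ⟨(openGraph_adj ω a b).2 ⟨hab.1, hab.2.2.2⟩, Finset.mem_coe.2 hab.2.2.1⟩
  · intro h
    obtain ⟨-, hr⟩ := DCT16.pathIn_of_mem_openConnIn h
    -- carry `current vertex ∈ S` along the path
    suffices key : ∀ b, Relation.ReflTransGen (fun a b => (openGraph ω).Adj a b ∧ b ∈ (↑S : Set V)) o b →
        b ∈ S ∧ IntConn S ω o b from (key x hr).2
    intro b hb
    induction hb with
    | refl => exact ⟨ho, IntConn.refl S ω o⟩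
    | @tail c e _ hce ih =>
      obtain ⟨hcS, hoc⟩ := ih
      have heS : e ∈ S := Finset.mem_coe.1 hce.2
      have hadj := (openGraph_adj ω c e).1 hce.1
      exact ⟨heS, hoc.tail hadj.1 hcS heS hadj.2⟩

/-! ### The mean-field differential inequality (Duminil-Copin–Tassion 2016, Lemma 1.4) -/

section MeanField

variable {d : ℕ}

/-- The internal and exit edges form the finite determining set `K`. [folklore] -/
theorem determinedBy_exitVia_zero (B T : Finset (Site d)) :
    DeterminedBy {ω : BondConfig (Site d) | ExitVia B T 0 ω} (↑(internalEdges B ∪ exitEdges B T)) :=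
  determinedBy_exitVia B T 0

/-- **Truncated `ψ_β(S)`**: `ψ^T_β(S) = Σ_{x ∈ S} (Σ_{y ∈ T \ S} J_{xy}) ℙ_β(0 ↔ x in S)` — the
`J`-weighted exit functional with the exits truncated to the finite set `T` (for `T ↑ ℤ^d` it
increases to `Σ_{x ∈ S} Σ_{y ∉ S} J_{xy} ℙ_β(0 ↔ x in S) ≥ φ_β(S)/β`).
[cite: DuminilCopinTassionCMP2016, (1.1) and Remark 1.1] -/
def kernelPsiIn (J : Sym2 (Site d) → ℝ) (β : ℝ) (S T : Finset (Site d)) : ℝ :=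
  ∑ x ∈ S, (∑ y ∈ T \ S, J s(x, y)) * (kernelPercolation J β).real {ω | IntConn S ω 0 x}

/-- `ψ^T_β(S) ≥ 0` for a nonnegative kernel. [folklore] -/
theorem kernelPsiIn_nonneg {J : Sym2 (Site d) → ℝ} (hJ : ∀ e, 0 ≤ J e) (β : ℝ)
    (S T : Finset (Site d)) : 0 ≤ kernelPsiIn J β S T :=
  Finset.sum_nonneg fun _ _ => mul_nonneg (Finset.sum_nonneg fun _ _ => hJ _) measureReal_nonneg

/-- Measurability of events determined by finitely many edges (`Site d` countable). [folklore] -/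
theorem measurableSet_of_determinedBy_finset {A : Set (BondConfig (Site d))}
    {F : Finset (Sym2 (Site d))} (hA : DeterminedBy A (↑F : Set (Sym2 (Site d)))) :
    MeasurableSet A :=
  hA.measurableSet_of_finset

/-- **The mean-field lower bound for the derivative** (Duminil-Copin–Tassion 2016, Lemma 1.4:
"`d/dβ ℙ[0 ↔ Λ^c] ≥ (1/β) inf_{S ⊆ Λ, 0 ∈ S} φ_β(S) (1 - ℙ[0 ↔ Λ^c])`", in the truncated finite
volume of their Remark 1.1 and with `Σ J_e ℙ_β(0 ↔ x in S) ≥ φ_β(S)/β` kept in `J`-form). For a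
nonnegative kernel, `β > 0` and finite `0 ∈ B ⊆ T`:
`d/dβ ℙ_β(0 ↔ out) ≥ (min_{S ⊆ B, 0 ∈ S} ψ^T_β(S)) · (1 - ℙ_β(0 ↔ out))`, where the derivative is
given by Russo's formula. [cite: DuminilCopinTassionCMP2016, Lemma 1.4] -/
theorem hasDerivAt_real_exitVia_ge {J : Sym2 (Site d) → ℝ} (hJ : ∀ e, 0 ≤ J e) {β : ℝ}
    (hβ : 0 < β) {B T : Finset (Site d)} (h0 : (0 : Site d) ∈ B) {m : ℝ}
    (hm : ∀ S ∈ B.powerset, (0 : Site d) ∈ S → m ≤ kernelPsiIn J β S T) :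
    ∃ D : ℝ, HasDerivAt (fun b : ℝ => (kernelPercolation J b).real {ω | ExitVia B T 0 ω}) D β ∧
      m * (1 - (kernelPercolation J β).real {ω | ExitVia B T 0 ω}) ≤ D := by
  classical
  set μ := kernelPercolation J β with hμ
  set A : Set (BondConfig (Site d)) := {ω | ExitVia B T 0 ω} with hAdef
  set K := internalEdges B ∪ exitEdges B T with hK
  have hA : IsUpperSet A := isUpperSet_exitVia B T 0
  have hAK : DeterminedBy A ↑K := determinedBy_exitVia B T 0
  have hAm : MeasurableSet A := hAK.measurableSet_of_finset
  -- Russo's formula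
  refine ⟨∑ e ∈ K, J e * Real.exp (-(β * J e)) * μ.real {ω | IsPivotal A e ω},
    hasDerivAt_kernelPercolation_real hJ hA hAK hβ, ?_⟩
  -- Step 1: `J_e e^{-βJ_e} P(e pivotal) ≥ J_e P(e pivotal, ¬A)`
  have hstep1 : ∀ e ∈ K, J e * μ.real ({ω | IsPivotal A e ω} ∩ Aᶜ) ≤
      J e * Real.exp (-(β * J e)) * μ.real {ω | IsPivotal A e ω} := by
    intro e he
    have hpivK : DeterminedBy {ω | IsPivotal A e ω} (↑(K.erase e) : Set (Sym2 (Site d))) :=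
      Russo.determinedBy_isPivotal hAK e
    have hpivm : MeasurableSet {ω : BondConfig (Site d) | IsPivotal A e ω} :=
      hpivK.measurableSet_of_finset
    -- `P(piv ∩ {e closed}) = P(e closed) P(piv)` by independence
    have hind : μ.real ({ω : BondConfig (Site d) | e ∉ ω} ∩ {ω | IsPivotal A e ω}) =
        μ.real {ω : BondConfig (Site d) | e ∉ ω} * μ.real {ω | IsPivotal A e ω} := by
      refine prodBernoulli_real_inter_of_determinedBy_disjoint _ (F := {e}) (F' := K.erase e)
        (by simp) ?_ hpivK (measurableSet_notMem e) hpivm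
      rw [determinedBy_iff]
      intro ω ω' h
      have := Set.ext_iff.1 h e
      simp only [Finset.coe_singleton, Set.mem_inter_iff, Set.mem_singleton_iff, and_true] at this
      simp only [Set.mem_setOf_eq, this]
    have hclosed : μ.real {ω : BondConfig (Site d) | e ∉ ω} = Real.exp (-(β * J e)) := by
      rw [hμ, kernelPercolation, prodBernoulli_real_setOf_notMem,
        coe_kernelEdgeProb (mul_nonneg hβ.le (hJ e))]
      ring
    have hsub : {ω | IsPivotal A e ω} ∩ Aᶜ ⊆ {ω : BondConfig (Site d) | e ∉ ω} ∩ {ω | IsPivotal A e ω} :=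
      fun ω hω => ⟨notMem_of_isPivotal_of_notMem hA hω.1 hω.2, hω.1⟩
    calc J e * μ.real ({ω | IsPivotal A e ω} ∩ Aᶜ)
        ≤ J e * μ.real ({ω : BondConfig (Site d) | e ∉ ω} ∩ {ω | IsPivotal A e ω}) :=
          mul_le_mul_of_nonneg_left (measureReal_mono hsub (measure_ne_top _ _)) (hJ e)
      _ = J e * Real.exp (-(β * J e)) * μ.real {ω | IsPivotal A e ω} := by
          rw [hind, hclosed]; ring
  refine le_trans ?_ (Finset.sum_le_sum hstep1)
  -- Step 2: decompose `Aᶜ` along the values of `𝒮 ∋ 0`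
  set PS := B.powerset.filter fun S => (0 : Site d) ∈ S with hPS
  have hSm : ∀ S, MeasurableSet {ω : BondConfig (Site d) | notExitSet B T ω = S} := fun S =>
    (determinedBy_notExitSet_eq B T S).measurableSet_of_finset
  have hdisjS : Set.PairwiseDisjoint (↑PS : Set (Finset (Site d)))
      fun S => {ω : BondConfig (Site d) | notExitSet B T ω = S} := by
    intro S _ S' _ hSS'
    exact Set.disjoint_left.2 fun ω h h' => hSS' (h.symm.trans h')
  have hstep2 : ∀ e ∈ K, ∑ S ∈ PS, μ.real ({ω | IsPivotal A e ω} ∩ {ω | notExitSet B T ω = S}) ≤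
      μ.real ({ω | IsPivotal A e ω} ∩ Aᶜ) := by
    intro e he
    have hpivm : MeasurableSet {ω : BondConfig (Site d) | IsPivotal A e ω} :=
      (Russo.determinedBy_isPivotal hAK e).measurableSet_of_finset
    rw [← measureReal_biUnion_finset (hdisjS.mono fun S => Set.inter_subset_right)
      (fun S _ => hpivm.inter (hSm S))]
    refine measureReal_mono ?_ (measure_ne_top _ _)
    intro ω hω
    simp only [Set.mem_iUnion, Set.mem_inter_iff, Set.mem_setOf_eq, exists_prop] at hω
    obtain ⟨S, hSPS, hpiv, hS⟩ := hω
    refine ⟨hpiv, fun hA0 => ?_⟩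
    have h0S : (0 : Site d) ∈ S := (Finset.mem_filter.1 hSPS).2
    exact (mem_notExitSet.1 (hS ▸ h0S : (0 : Site d) ∈ notExitSet B T ω)).2 hA0
  have hstep2' : ∑ S ∈ PS, ∑ e ∈ K, J e * μ.real ({ω | IsPivotal A e ω} ∩ {ω | notExitSet B T ω = S}) ≤
      ∑ e ∈ K, J e * μ.real ({ω | IsPivotal A e ω} ∩ Aᶜ) := by
    rw [Finset.sum_comm]
    refine Finset.sum_le_sum fun e he => ?_
    rw [← Finset.mul_sum]
    exact mul_le_mul_of_nonneg_left (hstep2 e he) (hJ e)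
  refine le_trans ?_ hstep2'
  -- Step 3: restrict to the boundary edges `{x, y}`, `x ∈ S`, `y ∈ T \ S`, and use pivotality
  have hstep3 : ∀ S ∈ PS, ∑ x ∈ S, ∑ y ∈ T \ S, J s(x, y) *
      μ.real ({ω | notExitSet B T ω = S} ∩ {ω | IntConn S ω 0 x}) ≤
      ∑ e ∈ K, J e * μ.real ({ω | IsPivotal A e ω} ∩ {ω | notExitSet B T ω = S}) := by
    intro S hSPS
    obtain ⟨hSB, h0S⟩ := Finset.mem_filter.1 hSPS
    rw [Finset.mem_powerset] at hSB
    -- the injection `(x, y) ↦ {x, y}` into `K`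
    rw [← Finset.sum_product']
    have hinj : Set.InjOn (fun q : Site d × Site d => s(q.1, q.2)) ↑(S ×ˢ (T \ S)) := by
      rintro ⟨a, b⟩ hab ⟨a', b'⟩ hab' (h : s(a, b) = s(a', b'))
      simp only [Finset.coe_product, Set.mem_prod, Finset.mem_coe, Finset.mem_sdiff] at hab hab'
      rcases Sym2.eq_iff.1 h with ⟨rfl, rfl⟩ | ⟨rfl, rfl⟩
      · rfl
      · exact absurd hab.1 hab'.2.2
    have himage : (S ×ˢ (T \ S)).image (fun q : Site d × Site d => s(q.1, q.2)) ⊆ K := by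
      intro e he
      obtain ⟨⟨a, b⟩, hab, rfl⟩ := Finset.mem_image.1 he
      simp only [Finset.mem_product, Finset.mem_sdiff] at hab
      by_cases hbB : b ∈ B
      · exact Finset.mem_union_left _ (mk_mem_internalEdges.2 ⟨hSB hab.1, hbB, fun h =>
          hab.2.2 (by rw [← show a = b from h]; exact hab.1)⟩)
      · exact Finset.mem_union_right _ ((mk_mem_exitEdges (hSB hab.1)).2 ⟨hab.2.1, hbB⟩)
    calc ∑ q ∈ S ×ˢ (T \ S), J s(q.1, q.2) *
          μ.real ({ω | notExitSet B T ω = S} ∩ {ω | IntConn S ω 0 q.1})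
        ≤ ∑ q ∈ S ×ˢ (T \ S), J s(q.1, q.2) *
          μ.real ({ω | IsPivotal A s(q.1, q.2) ω} ∩ {ω | notExitSet B T ω = S}) := by
          refine Finset.sum_le_sum fun q hq => mul_le_mul_of_nonneg_left
            (measureReal_mono (fun ω hω => ?_) (measure_ne_top _ _)) (hJ _)
          simp only [Finset.mem_product, Finset.mem_sdiff] at hq
          exact ⟨isPivotal_exitVia_of_notExitSet_eq hω.1 h0S hq.1 hω.2 hq.2.1 hq.2.2, hω.1⟩
      _ = ∑ e ∈ (S ×ˢ (T \ S)).image (fun q : Site d × Site d => s(q.1, q.2)),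
          J e * μ.real ({ω | IsPivotal A e ω} ∩ {ω | notExitSet B T ω = S}) := by
          rw [Finset.sum_image hinj]
      _ ≤ ∑ e ∈ K, J e * μ.real ({ω | IsPivotal A e ω} ∩ {ω | notExitSet B T ω = S}) :=
          Finset.sum_le_sum_of_subset_of_nonneg himage fun e _ _ =>
            mul_nonneg (hJ e) measureReal_nonneg
  refine le_trans ?_ (Finset.sum_le_sum hstep3)
  -- Step 4: independence of `{𝒮 = S}` and `{0 ↔ x in S}`, then the minimum over `S`
  have hstep4 : ∀ S ∈ PS, ∑ x ∈ S, ∑ y ∈ T \ S, J s(x, y) *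
      μ.real ({ω | notExitSet B T ω = S} ∩ {ω | IntConn S ω 0 x}) =
      μ.real {ω | notExitSet B T ω = S} * kernelPsiIn J β S T := by
    intro S hSPS'
    have hSB : S ⊆ B := Finset.mem_powerset.1 (Finset.mem_filter.1 hSPS').1
    have hdisjF : Disjoint ((internalEdges B \ internalEdges S) ∪ exitEdges B T) (internalEdges S) := by
      rw [Finset.disjoint_union_left]
      refine ⟨Finset.sdiff_disjoint, ?_⟩
      rw [Finset.disjoint_left]
      intro e he he'
      obtain ⟨a, b, rfl, -, -, hbB⟩ := exists_of_mem_exitEdges he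
      exact hbB (hSB (mk_mem_internalEdges.1 he').2.1)
    rw [kernelPsiIn, Finset.mul_sum]
    refine Finset.sum_congr rfl fun x _ => ?_
    have hind : μ.real ({ω | notExitSet B T ω = S} ∩ {ω | IntConn S ω 0 x}) =
        μ.real {ω | notExitSet B T ω = S} * μ.real {ω | IntConn S ω 0 x} :=
      prodBernoulli_real_inter_of_determinedBy_disjoint (kernelEdgeProb J β) hdisjF
        (determinedBy_notExitSet_eq B T S) (determinedBy_intConn S 0 x) (hSm S)
        ((determinedBy_intConn S 0 x).measurableSet_of_finset)
    rw [← Finset.sum_mul, hind, hμ]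
    ring
  -- the events `{𝒮 = S}`, `S ∋ 0`, partition `Aᶜ`
  have hcover : (⋃ S ∈ PS, {ω : BondConfig (Site d) | notExitSet B T ω = S}) = Aᶜ := by
    ext ω
    simp only [Set.mem_iUnion, Set.mem_setOf_eq, exists_prop, Set.mem_compl_iff]
    constructor
    · rintro ⟨S, hSPS, hS⟩ hA0
      have h0S : (0 : Site d) ∈ S := (Finset.mem_filter.1 hSPS).2
      exact (mem_notExitSet.1 (hS ▸ h0S : (0 : Site d) ∈ notExitSet B T ω)).2 hA0
    · intro hA0
      exact ⟨notExitSet B T ω, Finset.mem_filter.2 ⟨Finset.mem_powerset.2 (notExitSet_subset B T ω),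
        mem_notExitSet.2 ⟨h0, hA0⟩⟩, rfl⟩
  calc m * (1 - μ.real A) = m * μ.real Aᶜ := by rw [measureReal_compl hAm, probReal_univ]
    _ = m * ∑ S ∈ PS, μ.real {ω | notExitSet B T ω = S} := by
        rw [← hcover, measureReal_biUnion_finset hdisjS (fun S _ => hSm S)]
    _ = ∑ S ∈ PS, μ.real {ω | notExitSet B T ω = S} * m := by
        rw [Finset.mul_sum]
        exact Finset.sum_congr rfl fun _ _ => mul_comm _ _
    _ ≤ ∑ S ∈ PS, μ.real {ω | notExitSet B T ω = S} * kernelPsiIn J β S T :=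
        Finset.sum_le_sum fun S hS => mul_le_mul_of_nonneg_left
          (hm S (Finset.mem_filter.1 hS).1 (Finset.mem_filter.1 hS).2) measureReal_nonneg
    _ = ∑ S ∈ PS, ∑ x ∈ S, ∑ y ∈ T \ S, J s(x, y) *
          μ.real ({ω | notExitSet B T ω = S} ∩ {ω | IntConn S ω 0 x}) :=
        (Finset.sum_congr rfl hstep4).symm

end MeanField

end Literature.Probability.Percolation

end
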